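import Literature.AlgebraicGeometry.Resolution.ArithmeticalThreefoldsLocalDescentEmbChain3
import HarnessLib

/-!
# Cossart–Piltant 2019, Prop. 4.10: the (C4) chain re-keyed on CJS Thm. 1.4 (`B = ∅`) — part 4

Topic: `Literature/AlgebraicGeometry/Resolution` (proofs only: no new notions, no new named facts).

The chain `ArithmeticalThreefoldsLocalDescent{Steps, Kummer, KummerStableLocalRing, Layers, InertiaClimb,
InertiaStableLocalRing, InertiaHensel, DecompositionHead, MonomializationHead, Monomialization, Keyed,
EquivariantSplit}.lean` derives `CossartPiltant2019ReductionP` (Cossart–Piltant 2019, the residue-characteristic-`p`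
part of Prop. 4.10) from the local theorem, principalization, the descent inputs and — only as a PASS-THROUGH to the
rank-one reduction (C5) at its bottom — the non-embedded resolution of excellent surfaces `CossartJannsenSaito2020General`
(CJS Thm. 1.2).  Since (C5) is now served by the EMBEDDED theorem (`rankOne_reduction_of_cjsEmbedded`,
`ArithmeticalThreefoldsLocalRankReductionEmbeddedFrame.lean`), this file repeats the chain with the hypothesis
`CossartJannsenSaito2020General` replaced by `CossartJannsenSaito2020Embedded` (CJS Thm. 1.4, `B = ∅` — the type of
stub 1 of the `CleanModels` crux of the summit `ResolutionOfSingularities`); statements and proofs are otherwise those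
of the originals, verbatim (names: `…_of_emb_of_…` / `…_of_embPrinted_of_…`).

## Sources

* V. Cossart, O. Piltant, *Resolution of singularities of arithmetical threefolds*, J. Algebra 529 (2019),
  proof of Prop. 4.10 (arXiv v1: Prop. 4.8, pp. 53–54). [CossartPiltant2019]
* V. Cossart, O. Piltant, *Resolution of singularities of threefolds in positive characteristic I*, J. Algebra 320
  (2008), §§6–9. [CossartPiltant2008]
* V. Cossart, U. Jannsen, S. Saito, LNM 2270 (2020), Thm. 1.4, Cor. 1.5. [CossartJannsenSaito2020]
-/

noncomputable section

open CategoryTheory AlgebraicGeometry TopologicalSpace IsLocalRing _root_.Polynomial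
  _root_.IntermediateField

namespace Literature.AlgebraicGeometry.Resolution

universe u

/-- (RE-KEYED on Cossart–Jannsen–Saito Thm. 1.4 with `B = ∅`: statement and proof as the original of the same name with `cjs`/`printed` replaced by `emb`/`embPrinted`, the rank-one reduction (C5) being served by `rankOne_reduction_of_cjsEmbedded` instead of the non-embedded CJS Thm. 1.2, which is no longer an input.) **Cossart–Piltant 2019, Prop. 4.10 from Thm. 1.5, principalization, resolution of excellent
surfaces, the tame and inertia stability inputs, and the GEOMETRIC HEAD of the decomposition
layer of [CoP1] Prop. 9.3** (Prop. 8.1 (1)–(2), model reading, applied to the normal local model of `K′` above a normal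
model of `M`, with the choice (46) of the `fᵢ`):
`cossartPiltant2019ReductionP_of_emb_of_stableInertiaHensel` with `hDec` discharged by
`exists_localUniformization_of_head'`.
[cite: CossartPiltant2019, Props. 4.3, 4.4 and proof of Prop. 4.10 (arXiv v1: Props. 4.2, 4.3, 4.8, pp. 50–54)]
[cite: CossartPiltant2008, Prop. 8.1, Lemma 9.4, Prop. 9.3 and its proof (HAL pp. 22, 26–30)]
[cite: CossartJannsenSaito2020, Thm. 1.2, Cor. 1.5] -/
theorem cossartPiltant2019ReductionP_of_emb_of_stableInertia_of_head
    (hloc : CossartPiltant2019Local.{u}) (h44 : CossartPiltant2019Principalization.{u})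
    (hCJSE : CossartJannsenSaito2020Embedded.{u})
    (hEmb : ∀ (Z : Scheme.{u}) [IsIntegral Z] [IsNoetherian Z], Scheme.IsRegular Z →
      Scheme.IsExcellent Z → ∀ (X : Set Z), IsClosed X → X ≠ Set.univ → topologicalKrullDim X ≤ 2 →
        ∃ (Z' : Scheme.{u}) (π : Z' ⟶ Z), IsProper π ∧ Function.Surjective π.base ∧
          (∃ U : Z.Opens, (U : Set Z) = Xᶜ ∧ IsIso (π ∣_ U)) ∧
          IsStrictNormalCrossingsDivisor Z' (π.base ⁻¹' X))
    (hStabLoc :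
      ∀ (p : ℕ), p.Prime →
      ∀ (S : Type u) [CommRing S] [IsDomain S] [IsRegularLocalRing S],
        IsExcellentRing S → ringKrullDim S = 3 → CharP (ResidueField S) p →
        IsAdicComplete (maximalIdeal S) S →
      ∀ (E : Type u) [Field E] [Algebra S E], Function.Injective (algebraMap S E) →
        IsAlgClosed E → Algebra.IsAlgebraic S E →
      ∀ (OE : ValuationSubring E), (∀ s : S, algebraMap S E s ∈ OE) →
        (∀ s ∈ maximalIdeal S, OE.valuation (algebraMap S E s) < 1) →
        (∀ y : OE, ∃ q : S[X], (∃ i, q.coeff i ∉ maximalIdeal S) ∧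
          OE.valuation (q.eval₂ (algebraMap S E) y) < 1) →
      Nonempty OE.valuation.RankOne →
      ∀ (ℓ : ℕ), ℓ.Prime → ℓ ≠ p → ∀ (ζ : E), IsPrimitiveRoot ζ ℓ →
      ∀ (A : Subfield E), (∀ s : S, algebraMap S E s ∈ A) → ζ ∈ A →
      ∀ (θ : E), θ ∉ A → θ ^ ℓ ∈ A → OE.valuation θ ≤ 1 →
        Module.finrank A (adjoin A ({θ} : Set E)) = ℓ → IsGalois A (adjoin A ({θ} : Set E)) →
        inertiaGroupIn OE (adjoin A ({θ} : Set E)) = ⊤ →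
        (∃ t : Finset E, (t : Set E) ⊆ (adjoin A ({θ} : Set E)).toSubfield ∧
          (adjoin A ({θ} : Set E)).toSubfield ≤
            Subfield.closure (Set.range (algebraMap S E) ∪ (t : Set E)) ∧
          ∃ hTO : (Algebra.adjoin S (t : Set E)).toSubring ≤ OE.toSubring,
            IsRegularLocalRing (Localization.AtPrime
              (Ideal.comap (Subring.inclusion hTO) (maximalIdeal OE)))) →
        (∃ t : Finset E, (t : Set E) ⊆ (adjoin A ({θ} : Set E)).toSubfield ∧
          (adjoin A ({θ} : Set E)).toSubfield ≤
            Subfield.closure (Set.range (algebraMap S E) ∪ (t : Set E)) ∧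
          ∃ hTO : (Algebra.adjoin S (t : Set E)).toSubring ≤ OE.toSubring,
            IsRegularLocalRing (Localization.AtPrime
              (Ideal.comap (Subring.inclusion hTO) (maximalIdeal OE))) ∧
            ∀ (τ : adjoin A ({θ} : Set E) ≃ₐ[A] adjoin A ({θ} : Set E))
              (x : adjoin A ({θ} : Set E)),
              (x : E) ∈ locAtCentre (Algebra.adjoin S (t : Set E)).toSubring OE →
              ((τ x : adjoin A ({θ} : Set E)) : E) ∈
                locAtCentre (Algebra.adjoin S (t : Set E)).toSubring OE))
    (hStabIη :
      ∀ (p : ℕ), p.Prime →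
      ∀ (S : Type u) [CommRing S] [IsDomain S] [IsRegularLocalRing S],
        IsExcellentRing S → ringKrullDim S = 3 → CharP (ResidueField S) p →
        IsAdicComplete (maximalIdeal S) S →
      ∀ (E : Type u) [Field E] [Algebra S E], Function.Injective (algebraMap S E) →
        IsAlgClosed E → Algebra.IsAlgebraic S E →
      ∀ (OE : ValuationSubring E), (∀ s : S, algebraMap S E s ∈ OE) →
        (∀ s ∈ maximalIdeal S, OE.valuation (algebraMap S E s) < 1) →
        (∀ y : OE, ∃ q : S[X], (∃ i, q.coeff i ∉ maximalIdeal S) ∧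
          OE.valuation (q.eval₂ (algebraMap S E) y) < 1) →
      Nonempty OE.valuation.RankOne →
      ∀ (M : Subfield E), (∀ s : S, algebraMap S E s ∈ M) →
      ∀ (N : IntermediateField M E) [FiniteDimensional M N] [IsGalois M N],
      ∀ (η : E), η ∈ OE → η ∈ (lift (fixedField (inertiaGroupIn OE N))).toSubfield →
        (∃ F : Polynomial E, F.Monic ∧
          (∀ k, F.coeff k ∈ OE ∧
            F.coeff k ∈ (lift (fixedField (decompositionGroupIn OE N))).toSubfield) ∧
          F.eval η = 0 ∧ OE.valuation ((derivative F).eval η) = 1) →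
        (lift (fixedField (inertiaGroupIn OE N))).toSubfield =
          (IntermediateField.adjoin (lift (fixedField (decompositionGroupIn OE N))).toSubfield
            ({η} : Set E)).toSubfield →
        (∃ t : Finset E, (t : Set E) ⊆ (lift (fixedField (inertiaGroupIn OE N))).toSubfield ∧
          (lift (fixedField (inertiaGroupIn OE N))).toSubfield ≤
            Subfield.closure (Set.range (algebraMap S E) ∪ (t : Set E)) ∧
          ∃ hTO : (Algebra.adjoin S (t : Set E)).toSubring ≤ OE.toSubring,
            IsRegularLocalRing (Localization.AtPrime
              (Ideal.comap (Subring.inclusion hTO) (maximalIdeal OE)))) →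
        ∃ t : Finset E, (t : Set E) ⊆ (lift (fixedField (inertiaGroupIn OE N))).toSubfield ∧
          (lift (fixedField (inertiaGroupIn OE N))).toSubfield ≤
            Subfield.closure (Set.range (algebraMap S E) ∪ (t : Set E)) ∧
          ∃ hTO : (Algebra.adjoin S (t : Set E)).toSubring ≤ OE.toSubring,
            IsRegularLocalRing (Localization.AtPrime
              (Ideal.comap (Subring.inclusion hTO) (maximalIdeal OE))) ∧
            (∀ τ ∈ decompositionGroupIn OE N, ∀ x : N,
              (x : E) ∈ locAtCentre (Algebra.adjoin S (t : Set E)).toSubring OE →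
              ((τ x : N) : E) ∈ locAtCentre (Algebra.adjoin S (t : Set E)).toSubring OE) ∧
            η ∈ locAtCentre (Algebra.adjoin S (t : Set E)).toSubring OE)
    (hHead :
      ∀ (p : ℕ), p.Prime →
      ∀ (S : Type u) [CommRing S] [IsDomain S] [IsRegularLocalRing S],
        IsExcellentRing S → ringKrullDim S = 3 → CharP (ResidueField S) p →
        IsAdicComplete (maximalIdeal S) S →
      ∀ (E : Type u) [Field E] [Algebra S E], Function.Injective (algebraMap S E) →
        IsAlgClosed E → Algebra.IsAlgebraic S E →
      ∀ (OE : ValuationSubring E), (∀ s : S, algebraMap S E s ∈ OE) →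
        (∀ s ∈ maximalIdeal S, OE.valuation (algebraMap S E s) < 1) →
        (∀ y : OE, ∃ q : S[X], (∃ i, q.coeff i ∉ maximalIdeal S) ∧
          OE.valuation (q.eval₂ (algebraMap S E) y) < 1) →
      Nonempty OE.valuation.RankOne →
      ∀ (M : Subfield E), (∀ s : S, algebraMap S E s ∈ M) →
      ∀ (N : IntermediateField M E) [FiniteDimensional M N] [IsGalois M N] (K' : Subfield E),
        M ≤ K' → K' ≤ (lift (fixedField (decompositionGroupIn OE N))).toSubfield →
        (∃ t : Finset E, (t : Set E) ⊆ K' ∧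
          K' ≤ Subfield.closure (Set.range (algebraMap S E) ∪ (t : Set E)) ∧
          ∃ hTO : (Algebra.adjoin S (t : Set E)).toSubring ≤ OE.toSubring,
            IsRegularLocalRing (Localization.AtPrime
              (Ideal.comap (Subring.inclusion hTO) (maximalIdeal OE)))) →
      ∀ (t₁ : Finset E), (t₁ : Set E) ⊆ M →
        M ≤ Subfield.closure (Set.range (algebraMap S E) ∪ (t₁ : Set E)) →
        (Algebra.adjoin S (t₁ : Set E)).toSubring ≤ OE.toSubring →
        (∀ x : E, x ∈ M → IsIntegral (Algebra.adjoin S (t₁ : Set E)) x →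
          x ∈ Algebra.adjoin S (t₁ : Set E)) →
      ∀ (t₁' : Finset E), (t₁' : Set E) ⊆ K' →
        (∀ x : E, x ∈ K' → (IsIntegral (Algebra.adjoin S (t₁ : Set E)) x ↔
          x ∈ Algebra.adjoin S ((t₁ : Set E) ∪ (t₁' : Set E)))) →
      ∃ (t' : Finset E) (_ : (t' : Set E) ⊆ K')
        (hTO' : (Algebra.adjoin S (t' : Set E)).toSubring ≤ OE.toSubring)
        (_ : Algebra.adjoin S ((t₁ : Set E) ∪ (t₁' : Set E)) ≤ Algebra.adjoin S (t' : Set E))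
        (_ : IsRegularLocalRing (locAtCentre (Algebra.adjoin S (t' : Set E)).toSubring OE))
        (r : ℕ) (hr : r ≤ 3) (_ : 0 < r)
        (x : Fin 3 → locAtCentre (Algebra.adjoin S (t' : Set E)).toSubring OE),
        (∀ j, ((x j : locAtCentre (Algebra.adjoin S (t' : Set E)).toSubring OE) : E) ≠ 0) ∧
        (haveI := isLocalRing_locAtCentre hTO'
         Ideal.span (Set.range x) =
           maximalIdeal (locAtCentre (Algebra.adjoin S (t' : Set E)).toSubring OE)) ∧
        (∀ y : locAtCentre (Algebra.adjoin S (t' : Set E)).toSubring OE,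
          (y : E) ∈ locAtCentre (Algebra.adjoin S ((t₁ : Set E) ∪ (t₁' : Set E))).toSubring OE →
          OE.valuation (y : E) < 1 →
          y ∈ Ideal.span {∏ i : Fin r, x (Fin.castLE hr i)}) ∧
        (∃ (f : Fin r → E) (γ : Fin r → (locAtCentre (Algebra.adjoin S (t' : Set E)).toSubring OE)ˣ)
            (a : Matrix (Fin r) (Fin r) ℕ),
          (∀ i, f i ∈ M) ∧
          (∀ i, f i = ((γ i : locAtCentre (Algebra.adjoin S (t' : Set E)).toSubring OE) : E) *
            ∏ j, ((x (Fin.castLE hr j) :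
              locAtCentre (Algebra.adjoin S (t' : Set E)).toSubring OE) : E) ^ a i j) ∧
          (a.map (fun n : ℕ => (n : ℤ))).det ≠ 0) ∧
        (∃ (f₁ : E) (w : (locAtCentre (Algebra.adjoin S (t' : Set E)).toSubring OE)ˣ)
            (e : Fin r → ℕ),
          f₁ ∈ locAtCentre (Algebra.adjoin S ((t₁ : Set E) ∪ (t₁' : Set E))).toSubring OE ∧
          f₁ = ((w : locAtCentre (Algebra.adjoin S (t' : Set E)).toSubring OE) : E) *
            ∏ i, ((x (Fin.castLE hr i) :
              locAtCentre (Algebra.adjoin S (t' : Set E)).toSubring OE) : E) ^ e i ∧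
          ∀ z ∈ (t' : Set E), ∃ n : ℕ,
            f₁ ^ n * z ∈
              locAtCentre (Algebra.adjoin S ((t₁ : Set E) ∪ (t₁' : Set E))).toSubring OE)) :
    CossartPiltant2019ReductionP.{u} :=
  cossartPiltant2019ReductionP_of_emb_of_stableInertiaHensel hloc h44 hCJSE hEmb hStabLoc hStabIη
    (fun p hp S _ _ _ hS hSdim hSchar hScomp E _ _ hinj hE halg OE hSO hdom hres hrk M hSM N _ _ K'
        hMK' hK'Z hLUK' => by
      haveI := halg
      exact exists_localUniformization_of_head' hS hinj hScomp OE hSO hdom hres M hSM N K' hMK'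
        hK'Z hLUK' (hHead p hp S hS hSdim hSchar hScomp E hinj hE halg OE hSO hdom hres hrk M hSM
          N K' hMK' hK'Z hLUK'))

set_option maxHeartbeats 800000 in
/-- (RE-KEYED on Cossart–Jannsen–Saito Thm. 1.4 with `B = ∅`: statement and proof as the original of the same name with `cjs`/`printed` replaced by `emb`/`embPrinted`, the rank-one reduction (C5) being served by `rankOne_reduction_of_cjsEmbedded` instead of the non-embedded CJS Thm. 1.2, which is no longer an input.) **The chain for (C4) with the head of [CoP1] Prop. 9.3 replaced by monomialization with
denominator control** (`hMono`, see the module docstring); all of [CoP1] Prop. 8.1 after the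
principalization stage, the choice (46), property (1) and the extraction of the head are
discharged by `head_conclusion_of_monomialization`.
[cite: CossartPiltant2019, Props. 4.3, 4.4 and proof of Prop. 4.10 (arXiv v1: Props. 4.2, 4.3, 4.8, pp. 50–54)]
[cite: CossartPiltant2008, Prop. 4.1, Prop. 8.1, Prop. 9.3 and their proofs (HAL pp. 6–7, 22–23, 26–30)] -/
theorem cossartPiltant2019ReductionP_of_emb_of_stableInertia_of_monomialization
    (hloc : CossartPiltant2019Local.{u}) (h44 : CossartPiltant2019Principalization.{u})
    (hCJSE : CossartJannsenSaito2020Embedded.{u})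
    (hEmb : ∀ (Z : Scheme.{u}) [IsIntegral Z] [IsNoetherian Z], Scheme.IsRegular Z →
      Scheme.IsExcellent Z → ∀ (X : Set Z), IsClosed X → X ≠ Set.univ → topologicalKrullDim X ≤ 2 →
        ∃ (Z' : Scheme.{u}) (π : Z' ⟶ Z), IsProper π ∧ Function.Surjective π.base ∧
          (∃ U : Z.Opens, (U : Set Z) = Xᶜ ∧ IsIso (π ∣_ U)) ∧
          IsStrictNormalCrossingsDivisor Z' (π.base ⁻¹' X))
    (hStabLoc :
      ∀ (p : ℕ), p.Prime →
      ∀ (S : Type u) [CommRing S] [IsDomain S] [IsRegularLocalRing S],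
        IsExcellentRing S → ringKrullDim S = 3 → CharP (ResidueField S) p →
        IsAdicComplete (maximalIdeal S) S →
      ∀ (E : Type u) [Field E] [Algebra S E], Function.Injective (algebraMap S E) →
        IsAlgClosed E → Algebra.IsAlgebraic S E →
      ∀ (OE : ValuationSubring E), (∀ s : S, algebraMap S E s ∈ OE) →
        (∀ s ∈ maximalIdeal S, OE.valuation (algebraMap S E s) < 1) →
        (∀ y : OE, ∃ q : S[X], (∃ i, q.coeff i ∉ maximalIdeal S) ∧
          OE.valuation (q.eval₂ (algebraMap S E) y) < 1) →
      Nonempty OE.valuation.RankOne →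
      ∀ (ℓ : ℕ), ℓ.Prime → ℓ ≠ p → ∀ (ζ : E), IsPrimitiveRoot ζ ℓ →
      ∀ (A : Subfield E), (∀ s : S, algebraMap S E s ∈ A) → ζ ∈ A →
      ∀ (θ : E), θ ∉ A → θ ^ ℓ ∈ A → OE.valuation θ ≤ 1 →
        Module.finrank A (adjoin A ({θ} : Set E)) = ℓ → IsGalois A (adjoin A ({θ} : Set E)) →
        inertiaGroupIn OE (adjoin A ({θ} : Set E)) = ⊤ →
        (∃ t : Finset E, (t : Set E) ⊆ (adjoin A ({θ} : Set E)).toSubfield ∧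
          (adjoin A ({θ} : Set E)).toSubfield ≤
            Subfield.closure (Set.range (algebraMap S E) ∪ (t : Set E)) ∧
          ∃ hTO : (Algebra.adjoin S (t : Set E)).toSubring ≤ OE.toSubring,
            IsRegularLocalRing (Localization.AtPrime
              (Ideal.comap (Subring.inclusion hTO) (maximalIdeal OE)))) →
        (∃ t : Finset E, (t : Set E) ⊆ (adjoin A ({θ} : Set E)).toSubfield ∧
          (adjoin A ({θ} : Set E)).toSubfield ≤
            Subfield.closure (Set.range (algebraMap S E) ∪ (t : Set E)) ∧
          ∃ hTO : (Algebra.adjoin S (t : Set E)).toSubring ≤ OE.toSubring,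
            IsRegularLocalRing (Localization.AtPrime
              (Ideal.comap (Subring.inclusion hTO) (maximalIdeal OE))) ∧
            ∀ (τ : adjoin A ({θ} : Set E) ≃ₐ[A] adjoin A ({θ} : Set E))
              (x : adjoin A ({θ} : Set E)),
              (x : E) ∈ locAtCentre (Algebra.adjoin S (t : Set E)).toSubring OE →
              ((τ x : adjoin A ({θ} : Set E)) : E) ∈
                locAtCentre (Algebra.adjoin S (t : Set E)).toSubring OE))
    (hStabIη :
      ∀ (p : ℕ), p.Prime →
      ∀ (S : Type u) [CommRing S] [IsDomain S] [IsRegularLocalRing S],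
        IsExcellentRing S → ringKrullDim S = 3 → CharP (ResidueField S) p →
        IsAdicComplete (maximalIdeal S) S →
      ∀ (E : Type u) [Field E] [Algebra S E], Function.Injective (algebraMap S E) →
        IsAlgClosed E → Algebra.IsAlgebraic S E →
      ∀ (OE : ValuationSubring E), (∀ s : S, algebraMap S E s ∈ OE) →
        (∀ s ∈ maximalIdeal S, OE.valuation (algebraMap S E s) < 1) →
        (∀ y : OE, ∃ q : S[X], (∃ i, q.coeff i ∉ maximalIdeal S) ∧
          OE.valuation (q.eval₂ (algebraMap S E) y) < 1) →
      Nonempty OE.valuation.RankOne →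
      ∀ (M : Subfield E), (∀ s : S, algebraMap S E s ∈ M) →
      ∀ (N : IntermediateField M E) [FiniteDimensional M N] [IsGalois M N],
      ∀ (η : E), η ∈ OE → η ∈ (lift (fixedField (inertiaGroupIn OE N))).toSubfield →
        (∃ F : Polynomial E, F.Monic ∧
          (∀ k, F.coeff k ∈ OE ∧
            F.coeff k ∈ (lift (fixedField (decompositionGroupIn OE N))).toSubfield) ∧
          F.eval η = 0 ∧ OE.valuation ((derivative F).eval η) = 1) →
        (lift (fixedField (inertiaGroupIn OE N))).toSubfield =
          (IntermediateField.adjoin (lift (fixedField (decompositionGroupIn OE N))).toSubfield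
            ({η} : Set E)).toSubfield →
        (∃ t : Finset E, (t : Set E) ⊆ (lift (fixedField (inertiaGroupIn OE N))).toSubfield ∧
          (lift (fixedField (inertiaGroupIn OE N))).toSubfield ≤
            Subfield.closure (Set.range (algebraMap S E) ∪ (t : Set E)) ∧
          ∃ hTO : (Algebra.adjoin S (t : Set E)).toSubring ≤ OE.toSubring,
            IsRegularLocalRing (Localization.AtPrime
              (Ideal.comap (Subring.inclusion hTO) (maximalIdeal OE)))) →
        ∃ t : Finset E, (t : Set E) ⊆ (lift (fixedField (inertiaGroupIn OE N))).toSubfield ∧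
          (lift (fixedField (inertiaGroupIn OE N))).toSubfield ≤
            Subfield.closure (Set.range (algebraMap S E) ∪ (t : Set E)) ∧
          ∃ hTO : (Algebra.adjoin S (t : Set E)).toSubring ≤ OE.toSubring,
            IsRegularLocalRing (Localization.AtPrime
              (Ideal.comap (Subring.inclusion hTO) (maximalIdeal OE))) ∧
            (∀ τ ∈ decompositionGroupIn OE N, ∀ x : N,
              (x : E) ∈ locAtCentre (Algebra.adjoin S (t : Set E)).toSubring OE →
              ((τ x : N) : E) ∈ locAtCentre (Algebra.adjoin S (t : Set E)).toSubring OE) ∧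
            η ∈ locAtCentre (Algebra.adjoin S (t : Set E)).toSubring OE)
    (hMono :
      ∀ (p : ℕ), p.Prime →
      ∀ (S : Type u) [CommRing S] [IsDomain S] [IsRegularLocalRing S],
        IsExcellentRing S → ringKrullDim S = 3 → CharP (ResidueField S) p →
        IsAdicComplete (maximalIdeal S) S →
      ∀ (E : Type u) [Field E] [Algebra S E], Function.Injective (algebraMap S E) →
        IsAlgClosed E → Algebra.IsAlgebraic S E →
      ∀ (OE : ValuationSubring E), (∀ s : S, algebraMap S E s ∈ OE) →
        (∀ s ∈ maximalIdeal S, OE.valuation (algebraMap S E s) < 1) →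
        (∀ y : OE, ∃ q : S[X], (∃ i, q.coeff i ∉ maximalIdeal S) ∧
          OE.valuation (q.eval₂ (algebraMap S E) y) < 1) →
      Nonempty OE.valuation.RankOne →
      ∀ (M : Subfield E), (∀ s : S, algebraMap S E s ∈ M) →
      ∀ (N : IntermediateField M E) [FiniteDimensional M N] [IsGalois M N] (K' : Subfield E),
        M ≤ K' → K' ≤ (lift (fixedField (decompositionGroupIn OE N))).toSubfield →
        (∃ t : Finset E, (t : Set E) ⊆ K' ∧
          K' ≤ Subfield.closure (Set.range (algebraMap S E) ∪ (t : Set E)) ∧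
          ∃ hTO : (Algebra.adjoin S (t : Set E)).toSubring ≤ OE.toSubring,
            IsRegularLocalRing (Localization.AtPrime
              (Ideal.comap (Subring.inclusion hTO) (maximalIdeal OE)))) →
      ∀ (t : Finset E), (t : Set E) ⊆ K' →
        ∀ hTO : (Algebra.adjoin S (t : Set E)).toSubring ≤ OE.toSubring,
        IsRegularLocalRing (locAtCentre (Algebra.adjoin S (t : Set E)).toSubring OE) →
        ∀ G : E, G ∈ locAtCentre (Algebra.adjoin S (t : Set E)).toSubring OE → G ≠ 0 →
          OE.valuation G < 1 →
        ∃ t' : Finset E, t ⊆ t' ∧ (t' : Set E) ⊆ K' ∧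
          ∃ hT'O : (Algebra.adjoin S (t' : Set E)).toSubring ≤ OE.toSubring,
          IsRegularLocalRing (locAtCentre (Algebra.adjoin S (t' : Set E)).toSubring OE) ∧
          ∃ (x : Fin 3 → locAtCentre (Algebra.adjoin S (t' : Set E)).toSubring OE) (u : E)
            (α : Fin 3 → ℕ),
            (haveI := isLocalRing_locAtCentre hT'O
             Ideal.span (Set.range x) = maximalIdeal _) ∧
            u ∈ locAtCentre (Algebra.adjoin S (t' : Set E)).toSubring OE ∧ OE.valuation u = 1 ∧
            G = u * ∏ c, (x c : E) ^ α c ∧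
            ∀ z ∈ (t' : Set E), ∃ a b : E,
              a ∈ locAtCentre (Algebra.adjoin S (t : Set E)).toSubring OE ∧
              b ∈ locAtCentre (Algebra.adjoin S (t : Set E)).toSubring OE ∧ a ≠ 0 ∧ z * a = b ∧
              ∃ (N : ℕ) (c : E), c ∈ locAtCentre (Algebra.adjoin S (t' : Set E)).toSubring OE ∧
                G ^ N = a * c) :
    CossartPiltant2019ReductionP.{u} :=
  cossartPiltant2019ReductionP_of_emb_of_stableInertia_of_head hloc h44 hCJSE hEmb hStabLoc hStabIη
    (fun p hp S _ _ _ hS hSdim hSchar hScomp E _ _ hinj hE halg OE hSO hdom hres hrk M hSM N _ _ K'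
        hMK' hK'Z hLUK' t₁ ht₁M _ ht₁O _ t₁' ht₁'K' hext₁ => by
      haveI := halg
      exact head_conclusion_of_monomialization h44 hEmb hS hSdim hinj OE hSO hdom hres hrk M K' hSM
        hMK' hLUK' t₁ ht₁M ht₁O t₁' ht₁'K' hext₁
        (hMono p hp S hS hSdim hSchar hScomp E hinj hE halg OE hSO hdom hres hrk M hSM N K' hMK'
          hK'Z hLUK'))


end Literature.AlgebraicGeometry.Resolution

end
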